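import Summits.Ventures.PercRepro.S1CFSubst
import Summits.Ventures.PercRepro.S1CFCapsFour

/-!
# PercRepro — `D₄ ≤ 201` WITH AT MOST ONE DEPENDENT PAIR (p1, gen 37; stage 2 of the cap `D₄`)

For a loopless coloop-free matroid of nullity `4` on `12` points with `D₂ ≤ 1`: a point `x` on a triangle (if any) carries
`≤ 6` triangles (S1CFRelCover) and `≤ 20` `4`-circuits (**`ncard_fourCircuits_through_le_twenty`**: the relative circuits of
size `3` of `{x} ∪ (E ∖ {x})`, nullity `4`); the circuits avoiding `x` live in `E ∖ {x}`, of nullity `3`, and when the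
dependent pair `{a, a'}` lies there (choose `x ∉ {a, a'}`) the lifting halves the count into `E ∖ {x, a'}`, of nullity `2`:
`c₃ ≤ 6 + 2·C(4, 3) = 14`, `c₄ ≤ 20 + 2·C(5, 4) = 30`, `D₄ ≤ 45 + 9·14 + 30 = 201` (**`ncard_dep_four_le_of_eq_one`**);
with no dependent pair `c₃ ≤ 16`, `c₄ ≤ 35`, `D₄ ≤ 179` (**`ncard_dep_four_le_of_eq_zero`**).
Nothing about any cell is claimed. Axioms: standard.
-/

open scoped Matroid

namespace PercRepro

namespace S1CF

open Set

variable {α : Type}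

/-- **The `4`-circuits through a point number at most `20`** (nullity `4`). -/
theorem ncard_fourCircuits_through_le_twenty (M : Matroid α) [M.Finite] (hL : ∀ e ∈ M.E, ¬ M.IsLoop e)
    (hd : M.E.encard = M.eRank + ((4 : ℕ) : ℕ∞)) {x : α} (hx : x ∈ M.E) :
    {C : Set α | C ⊆ M.E ∧ M.IsCircuit C ∧ C.ncard = 4 ∧ x ∈ C}.ncard ≤ 20 := by
  classical
  have hEfin := M.ground_finite
  have hxI : M.Indep {x} := indep_singleton_of_not_isLoop M hx (hL x hx)
  have hU : {x} ∪ (M.E \ {x}) = M.E := by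
    rw [Set.singleton_union, Set.insert_sdiff_singleton, Set.insert_eq_of_mem hx]
  have hν : ({x} ∪ (M.E \ {x})).ncard ≤ (M.eRk ({x} ∪ (M.E \ {x}))).toNat + 4 := by
    rw [hU]; exact (ncard_ground_eq_eRk_toNat_add M hd).le
  have hrel := ncard_relCircuits_le M 3 (by norm_num) 4 {x} (M.E \ {x}) (Set.singleton_subset_iff.2 hx)
    sdiff_subset (Set.disjoint_singleton_left.2 (fun h => h.2 rfl)) hxI hν
  norm_num at hrel
  have hmap : ∀ C ∈ {C : Set α | C ⊆ M.E ∧ M.IsCircuit C ∧ C.ncard = 4 ∧ x ∈ C},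
      (fun C : Set α => C \ {x}) C ∈
        {P : Set α | P ⊆ M.E \ {x} ∧ P.ncard = 3 ∧ M.Dep ({x} ∪ P) ∧ ∀ Q, Q ⊂ P → M.Indep ({x} ∪ Q)} := by
    intro C hC
    obtain ⟨hCE, hCc, hC4, hxC⟩ := hC
    have hPeq : {x} ∪ (C \ {x}) = C := by
      rw [Set.singleton_union, Set.insert_sdiff_singleton, Set.insert_eq_of_mem hxC]
    refine ⟨Set.sdiff_subset_sdiff_left hCE, by rw [Set.ncard_sdiff_singleton_of_mem hxC, hC4],
      by rw [hPeq]; exact hCc.dep, ?_⟩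
    intro Q hQ
    have h : {x} ∪ Q ⊂ C := by
      rw [← hPeq]
      refine ⟨Set.union_subset_union_right {x} hQ.subset, ?_⟩
      intro hcon
      apply hQ.not_subset
      intro w hw
      rcases hcon (Or.inr hw) with h1 | h1
      · exact absurd (Set.mem_singleton_iff.1 h1) hw.2
      · exact h1
    exact hCc.ssubset_indep h
  have hinj : Set.InjOn (fun C : Set α => C \ {x}) {C : Set α | C ⊆ M.E ∧ M.IsCircuit C ∧ C.ncard = 4 ∧ x ∈ C} := by
    intro C hC C' hC' h
    simp only at h
    have e1 : C = insert x (C \ {x}) := by rw [Set.insert_sdiff_singleton, Set.insert_eq_of_mem hC.2.2.2]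
    have e2 : C' = insert x (C' \ {x}) := by rw [Set.insert_sdiff_singleton, Set.insert_eq_of_mem hC'.2.2.2]
    rw [e1, e2, h]
  exact (Set.ncard_le_ncard_of_injOn _ hmap hinj (relCircuits_finite M {x} (sdiff_subset) 3)).trans hrel

/-- Removing a point parallel to another point of `Y` does not change the rank. -/
theorem eRk_sdiff_singleton_eq_of_parallel (M : Matroid α) {Y : Set α} (hY : Y ⊆ M.E) {a a' : α} (ha : a ∈ Y)
    (haa' : a ≠ a') (ha' : a' ∈ M.closure {a}) : M.eRk (Y \ {a'}) = M.eRk Y := by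
  apply le_antisymm (M.eRk_mono sdiff_subset)
  have haY' : a ∈ Y \ {a'} := ⟨ha, fun h => haa' (Set.mem_singleton_iff.1 h)⟩
  have h : Y ⊆ M.closure (Y \ {a'}) := by
    intro w hw
    by_cases hwa' : w = a'
    · subst hwa'
      exact M.closure_subset_closure (Set.singleton_subset_iff.2 haY') ha'
    · exact M.subset_closure _ (sdiff_subset.trans hY) ⟨hw, hwa'⟩
  calc M.eRk Y ≤ M.eRk (M.closure (Y \ {a'})) := M.eRk_mono h
    _ = M.eRk (Y \ {a'}) := M.eRk_closure_eq _

/-- The circuits of size `k` inside `E ∖ {x}` number at most `C(k + 2, k)` (nullity `3`). -/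
theorem ncard_isCircuit_sdiff_singleton_le (M : Matroid α) [M.Finite] (hK : ∀ e, ¬ M.IsColoop e)
    (hd : M.E.encard = M.eRank + ((4 : ℕ) : ℕ∞)) {x : α} (hx : x ∈ M.E) {k : ℕ} (hk : 1 ≤ k) :
    {C : Set α | C ⊆ M.E \ {x} ∧ M.IsCircuit C ∧ C.ncard = k}.ncard ≤ (3 + k - 1).choose k :=
  ncard_isCircuit_ncard_eq_le M (ν := 3) hk (sdiff_subset : M.E \ {x} ⊆ M.E)
    (ncard_sdiff_singleton_le_eRk_toNat_add_three M hK hd hx)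

/-- The circuits of size `k` split into those through `x` and those inside `E ∖ {x}`. -/
theorem ncard_isCircuit_le_through_add_sdiff (M : Matroid α) [M.Finite] {x : α} (k : ℕ) :
    {C : Set α | C ⊆ M.E ∧ M.IsCircuit C ∧ C.ncard = k}.ncard ≤
      {C : Set α | C ⊆ M.E ∧ M.IsCircuit C ∧ C.ncard = k ∧ x ∈ C}.ncard +
        {C : Set α | C ⊆ M.E \ {x} ∧ M.IsCircuit C ∧ C.ncard = k}.ncard := by
  have hEfin := M.ground_finite
  have hsplit : {C : Set α | C ⊆ M.E ∧ M.IsCircuit C ∧ C.ncard = k} ⊆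
      {C : Set α | C ⊆ M.E ∧ M.IsCircuit C ∧ C.ncard = k ∧ x ∈ C} ∪
        {C : Set α | C ⊆ M.E \ {x} ∧ M.IsCircuit C ∧ C.ncard = k} := by
    intro C hC
    by_cases hxC : x ∈ C
    · exact Or.inl ⟨hC.1, hC.2.1, hC.2.2, hxC⟩
    · exact Or.inr ⟨Set.subset_sdiff_singleton hC.1 hxC, hC.2.1, hC.2.2⟩
  exact (Set.ncard_le_ncard hsplit ((hEfin.finite_subsets.subset (fun C hC => hC.1)).union
    (hEfin.finite_subsets.subset (fun C hC => hC.1.trans sdiff_subset)))).trans (Set.ncard_union_le _ _)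

/-- **`D₂ = 0 ⇒ D₄ ≤ 179`**: `9 · 16 + 35`. -/
theorem ncard_dep_four_le_of_eq_zero (M : Matroid α) [M.Finite] (hL : ∀ e ∈ M.E, ¬ M.IsLoop e)
    (hK : ∀ e, ¬ M.IsColoop e) (hd : M.E.encard = M.eRank + ((4 : ℕ) : ℕ∞)) (hn : M.E.ncard = 12)
    (h0 : {P : Set α | P ⊆ M.E ∧ P.ncard = 2 ∧ M.Dep P}.ncard = 0) :
    {X : Set α | X ⊆ M.E ∧ X.ncard = 4 ∧ M.Dep X}.ncard ≤ 179 := by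
  have hs := ncard_dep_four_le_split M hn
  have h3 := ncard_triangles_le_sixteen M hL hK hd (by omega)
  have h4 := ncard_fourCircuits_le_thirtyfive M hd
  omega

/-- **`D₂ = 1 ⇒ D₄ ≤ 201`**: `45 + 9·14 + 30`. -/
theorem ncard_dep_four_le_of_eq_one (M : Matroid α) [M.Finite] (hL : ∀ e ∈ M.E, ¬ M.IsLoop e)
    (hK : ∀ e, ¬ M.IsColoop e) (hd : M.E.encard = M.eRank + ((4 : ℕ) : ℕ∞)) (hn : M.E.ncard = 12)
    (h1 : {P : Set α | P ⊆ M.E ∧ P.ncard = 2 ∧ M.Dep P}.ncard = 1) :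
    {X : Set α | X ⊆ M.E ∧ X.ncard = 4 ∧ M.Dep X}.ncard ≤ 201 := by
  classical
  have hEfin := M.ground_finite
  have hs := ncard_dep_four_le_split M hn
  rw [h1] at hs
  -- the dependent pair
  obtain ⟨P₀, hP₀⟩ : {P : Set α | P ⊆ M.E ∧ P.ncard = 2 ∧ M.Dep P}.Nonempty := by
    rw [← Set.ncard_pos (hEfin.finite_subsets.subset (fun P hP => hP.1))]; omega
  obtain ⟨hP₀E, hP₀2, hP₀dep⟩ := hP₀
  obtain ⟨a, a', haa', rfl⟩ := Set.ncard_eq_two.1 hP₀2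
  have haE : a ∈ M.E := hP₀E (by simp)
  have ha'E : a' ∈ M.E := hP₀E (by simp)
  have ha'cl : a' ∈ M.closure {a} := mem_closure_singleton_of_dep_pair M haE (hL a haE) hP₀dep
  -- no triangle: `D₄ ≤ 45 + 35`
  rcases ({C : Set α | C ⊆ M.E ∧ M.IsCircuit C ∧ C.ncard = 3}).eq_empty_or_nonempty with hemp | ⟨T₀, hT₀⟩
  · have h3 : {C : Set α | C ⊆ M.E ∧ M.IsCircuit C ∧ C.ncard = 3}.ncard = 0 := by rw [hemp]; simp
    have h4 := ncard_fourCircuits_le_thirtyfive M hd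
    omega
  obtain ⟨hT₀E, hT₀c, hT₀3⟩ := hT₀
  -- a point of `T₀` outside `{a, a'}`
  obtain ⟨x, hxT₀, hxP⟩ : ∃ x ∈ T₀, x ∉ ({a, a'} : Set α) := by
    by_contra h
    push Not at h
    have : T₀ ⊆ ({a, a'} : Set α) := fun w hw => h w hw
    have := Set.ncard_le_ncard this (Set.toFinite _)
    rw [Set.ncard_pair haa', hT₀3] at this
    omega
  have hx : x ∈ M.E := hT₀E hxT₀
  have hxa : x ≠ a := fun h => hxP (by rw [h]; simp)
  have hxa' : x ≠ a' := fun h => hxP (by rw [h]; simp)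
  -- `E ∖ {x} ∖ {a'}` has nullity `2`
  have hY : M.E \ {x} ⊆ M.E := sdiff_subset
  have haY : a ∈ M.E \ {x} := ⟨haE, fun h => hxa (Set.mem_singleton_iff.1 h).symm⟩
  have hY' : (M.E \ {x}) \ {a'} ⊆ M.E := sdiff_subset.trans sdiff_subset
  have hrkY' : M.eRk ((M.E \ {x}) \ {a'}) = M.eRk (M.E \ {x}) :=
    eRk_sdiff_singleton_eq_of_parallel M hY haY haa' ha'cl
  have hν' : ((M.E \ {x}) \ {a'}).ncard ≤ (M.eRk ((M.E \ {x}) \ {a'})).toNat + 2 := by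
    have h3 := ncard_sdiff_singleton_le_eRk_toNat_add_three M hK hd hx
    have ha'Y : a' ∈ M.E \ {x} := ⟨ha'E, fun h => hxa' (Set.mem_singleton_iff.1 h).symm⟩
    have hc := Set.ncard_sdiff_singleton_add_one ha'Y (hEfin.subset hY)
    rw [hrkY']
    omega
  -- the triangles: `≤ 6 + 2 · C(4, 3)`
  have hc3 : {C : Set α | C ⊆ M.E ∧ M.IsCircuit C ∧ C.ncard = 3}.ncard ≤ 14 := by
    have hsplit := ncard_isCircuit_le_through_add_sdiff M (x := x) 3
    have h6 := ncard_triangles_through_le_six M hL hK hd (by omega) hx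
    have hlift := ncard_isCircuit_le_two_mul_sdiff M hL haE ha'E haa' hP₀dep hY haY (k := 3) (by norm_num)
    have hin := ncard_isCircuit_ncard_eq_le M (ν := 2) (k := 3) (by norm_num) hY' hν'
    norm_num at hin
    omega
  -- the `4`-circuits: `≤ 20 + 2 · C(5, 4)`
  have hc4 : {C : Set α | C ⊆ M.E ∧ M.IsCircuit C ∧ C.ncard = 4}.ncard ≤ 30 := by
    have hsplit := ncard_isCircuit_le_through_add_sdiff M (x := x) 4
    have h20 := ncard_fourCircuits_through_le_twenty M hL hd hx
    have hlift := ncard_isCircuit_le_two_mul_sdiff M hL haE ha'E haa' hP₀dep hY haY (k := 4) (by norm_num)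
    have hin := ncard_isCircuit_ncard_eq_le M (ν := 2) (k := 4) (by norm_num) hY' hν'
    norm_num at hin
    omega
  omega

end S1CF

end PercRepro
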